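import Literature.IUT.HodgeTheaters.InitialThetaDataLocalGalois
import Literature.IUT.HodgeTheaters.PuncturedEllipticCoveringsCor12Lem45
import HarnessLib

/-!
# [IUTchI] Def. 3.1 (d): number-field base data `G_K ≅ Gal(K̄/K)` for the core `Π_{C_K} ↠ G_K` of the
# `K`-level §1 datum — the `NFBase` of abc-iut-L4-t4 CONSTRUCTED (Krull continuity proved)

S. Mochizuki, *Inter-universal Teichmüller theory I*, kurims manuscript (May 2020), §3, Def. 3.1 (c)(d),
pp. 61–62 ([IUTchI] Def 3.1 p.61) [claim: Mochizuki2012, status: disputed]: "`K ⊆ F̄` … the finite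
Galois extension of `F`", "`C_K := C_F ×_F K`", with `G_K := Gal(F̄/K)` ((e), p. 62); and §1 Cor. 1.2
p. 39: "Suppose that `k` is an NF or an MLF."

ADDITIVE companion (one definition + its lemmas; nothing of abc-iut-L5-t2's REAL `InitialThetaData` /
`ThetaGeometry` is edited or restated) over abc-iut-L5-t2's `InitialThetaData` and the Galois plumbing
`InitialThetaDataLocalGalois` (`galoisSubgroupOfEquiv : Gal(F̄/K) ≃* G_K`, `localToGlobal`,
`continuous_localToGlobal`): for an initial Θ-datum with `K` and `F̄` in ONE universe, the Galois group
`pe.E.gal` of the core `Π_{C_K} ↠ G_K` of the `K`-level §1 datum `D.geom.pe` is identified BICONTINUOUSLY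
with Mathlib's absolute Galois group `Field.absoluteGaloisGroup K = Gal(K̄/K)` (Krull topology):

* `continuous_galKIso` — the frozen identification `galKIso : pe.E.gal ≃* G_K ⊆ G_F` is CONTINUOUS
  (derived from `aug_compat`, the bicontinuity of `galIso : Gal(C_F) ≃ G_F` and the continuity of
  `embK : Π_{C_K} ↪ Π_{C_F}`, through the quotient map `Π_{C_K} ↠ G_K`);
* `localToGlobal_bijective_of_algEquiv` — restriction along an ISOMORPHISM `ι : F̄ ≃ₐ[K] Ω` is a
  bijection `Gal(Ω/K) ⥲ Gal(F̄/K)`;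
* `absGalToGK` — `Gal(K̄/K) → G_K`, `σ ↦` (restriction of scalars to `F`) ∘ (transport along
  `F̄ ≅_K K̄`), a CONTINUOUS BIJECTIVE homomorphism (`continuous_absGalToGK`, `absGalToGK_bijective`);
* **`peNFBase : D.geom.pe.E.NFBase`** — number-field base data for the core of the `K`-level datum:
  base field `K`, `galIso := (pe.E.gal ≃ₜ G_K) ≫ (Gal(K̄/K) ≃ₜ G_K)⁻¹` (homeomorphisms by
  compact-to-Hausdorff);
* `pe_characteristicNatureOfCoverings_of_geomTFG'` / `pe_characteristicNatureOfCoverings_of_recoversCusps'`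
  — abc-iut-L5-d4's `pe_characteristicNatureOfCoverings_of_geomTFG` (p441649) /
  `pe_characteristicNatureOfCoverings_of_recoversCusps` (p442282) with their two `NFBase` DATA binders
  SUPPLIED: at the genuine `K`-level datum (universe `0`) the `Δ`-input of [IUTchI] Cor. 1.2 is
  [AbsTopI] Prop. 2.2 `GeomTFG` at the two cores ALONE.

Pure Galois theory + topology over Mathlib; nothing of the disputed series is asserted; no side is taken
on [IUTchIII] Cor. 3.12; no instance, no notation.
-/

noncomputable section

namespace Literature.IUT.HodgeTheaters

open scoped Pointwise
open Literature.AnabelianGeometry.AbsoluteAnabelian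
open Literature.AnabelianGeometry.AbsoluteAnabelian.FundamentalExtension (CuspidalAlgorithm)
open Literature.AnabelianGeometry.AbsoluteAnabelian.AbsTopII (semiEllipticDoubleCoverSubgroups)

universe u v

/-! ### Restriction along an isomorphism of algebraic closures is bijective -/

section Restriction

variable {K : Type v} [Field K] {Fbar : Type v} [Field Fbar] [Algebra K Fbar] [Normal K Fbar]
  {Ω : Type v} [Field Ω] [Algebra K Ω]

/-- Restriction `Gal(Ω/K) → Gal(F̄/K)` along a `K`-ISOMORPHISM `ι : F̄ ⥲ Ω` is bijective (inverse:
conjugation by `ι`). ([IUTchI] Def 3.1 p.61) [claim: Mochizuki2012, status: disputed] -/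
theorem localToGlobal_bijective_of_algEquiv (ι : Fbar ≃ₐ[K] Ω) :
    Function.Bijective (localToGlobal K (ι : Fbar →ₐ[K] Ω)) := by
  constructor
  · intro σ τ h
    apply AlgEquiv.ext
    intro y
    obtain ⟨x, rfl⟩ := ι.surjective y
    have hσ : ι (localToGlobal K (ι : Fbar →ₐ[K] Ω) σ x) = σ (ι x) :=
      apply_localToGlobal K (ι : Fbar →ₐ[K] Ω) σ x
    have hτ : ι (localToGlobal K (ι : Fbar →ₐ[K] Ω) τ x) = τ (ι x) :=
      apply_localToGlobal K (ι : Fbar →ₐ[K] Ω) τ x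
    rw [← hσ, ← hτ, h]
  · intro τ
    refine ⟨(ι.symm.trans τ).trans ι, (localToGlobal_unique K (ι : Fbar →ₐ[K] Ω) fun x => ?_).symm⟩
    change ι (τ x) = ((ι.symm.trans τ).trans ι) (ι x)
    simp only [AlgEquiv.trans_apply, AlgEquiv.symm_apply_apply]

end Restriction

namespace InitialThetaData

variable {F : Type u} {K : Type v} {Fbar : Type v} [Field F] [NumberField F] [Field K] [NumberField K]
  [Algebra F K] [Field Fbar] [Algebra F Fbar] [Algebra K Fbar]
  {E : WeierstrassCurve F} [E.IsElliptic] {l : ℕ} {Pb : BadPlacePredicates K}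
  (D : InitialThetaData F K Fbar E l Pb)

/-! ### Continuity of `galKIso : Gal(C_K) ≃ G_K` -/

/-- **The frozen identification `G_K`-side is continuous**: `galKIso : pe.E.gal ⥲ G_K ⊆ G_F` is
continuous — `G_K`-valued continuity is tested after the quotient map `Π_{C_K} ↠ pe.E.gal`, where by
`aug_compat` the composite is `galIso ∘ (Π_{C_F} ↠ G_F) ∘ embK`, continuous.
([IUTchI] Def 3.1 (d) p.62) [claim: Mochizuki2012, status: disputed] -/
theorem continuous_galKIso : Continuous D.geom.galKIso := by
  have hq : Topology.IsQuotientMap D.geom.pe.E.aug :=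
    (D.geom.pe.E.aug.continuous.isClosedMap).isQuotientMap D.geom.pe.E.aug.continuous
      D.geom.pe.E.aug_surjective
  rw [hq.continuous_iff]
  apply continuous_induced_rng.2
  have h : (Subtype.val ∘ (⇑D.geom.galKIso ∘ ⇑D.geom.pe.E.aug)) =
      fun x => D.geom.galIso (D.geom.extF.aug (D.geom.embK x)) :=
    funext fun x => (D.geom.aug_compat x).symm
  rw [h]
  exact D.geom.galIso_continuous.1.comp (D.geom.extF.aug.continuous.comp D.geom.embK_continuous)

include D in
/-- `F̄/F` is algebraic (it is an algebraic closure of `F`), hence `G_F = Gal(F̄/F)` is Hausdorff for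
the Krull topology. ([IUTchI] Def 3.1 (a) p.61) [claim: Mochizuki2012, status: disputed] -/
theorem t2Space_galF : T2Space (Fbar ≃ₐ[F] Fbar) := by
  haveI := D.isAlgClosure
  haveI : Algebra.IsIntegral F Fbar := Algebra.isAlgebraic_iff_isIntegral.mp inferInstance
  exact krullTopology_t2

include D in
/-- `F̄` is an algebraic closure of `K` as well (`K/F` algebraic, `F ⊆ K ⊆ F̄`).
([IUTchI] Def 3.1 (c) p.61) [claim: Mochizuki2012, status: disputed] -/
theorem isAlgClosure_K : IsAlgClosure K Fbar := by
  haveI := D.isAlgClosure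
  haveI := D.isScalarTower
  exact { isAlgClosed := IsAlgClosure.isAlgClosed F
          isAlgebraic := Algebra.IsAlgebraic.tower_top (K := F) K }

/-! ### `Gal(K̄/K) → G_K`, continuous and bijective -/

include D in
/-- A `K`-isomorphism `F̄ ⥲ K̄` with Mathlib's algebraic closure `K̄ = AlgebraicClosure K`.
([IUTchI] Def 3.1 (c) p.61) [claim: Mochizuki2012, status: disputed] -/
def algClosureEquiv : Fbar ≃ₐ[K] AlgebraicClosure K :=
  haveI := D.isAlgClosure_K
  IsAlgClosure.equiv K Fbar (AlgebraicClosure K)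

include D in
/-- **`Gal(K̄/K) → G_K ⊆ G_F`**: transport along `F̄ ≅_K K̄` (`localToGlobal`) followed by restriction
of scalars onto `G_K` (`galoisSubgroupOfEquiv`). ([IUTchI] Def 3.1 (e) p.62) [claim: Mochizuki2012,
status: disputed] -/
def absGalToGK : Field.absoluteGaloisGroup K →* galoisSubgroupOf F K Fbar :=
  haveI := D.isAlgClosure_K
  haveI := D.isScalarTower
  (galoisSubgroupOfEquiv F K Fbar).toMonoidHom.comp
    ((localToGlobal K (D.algClosureEquiv : Fbar →ₐ[K] AlgebraicClosure K)).comp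
      (Field.absoluteGaloisGroup.toAlgEquiv K).toMonoidHom)

/-- `Gal(K̄/K) → G_K` is bijective. ([IUTchI] Def 3.1 (e) p.62) [claim: Mochizuki2012, status:
disputed] -/
theorem absGalToGK_bijective : Function.Bijective D.absGalToGK := by
  haveI := D.isAlgClosure_K
  haveI := D.isScalarTower
  exact (galoisSubgroupOfEquiv F K Fbar).bijective.comp
    ((localToGlobal_bijective_of_algEquiv D.algClosureEquiv).comp
      (Field.absoluteGaloisGroup.toAlgEquiv K).bijective)

/-- `Gal(K̄/K) → G_K` is continuous (Krull topologies): `continuous_localToGlobal` and the tree's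
`continuous_restrictScalarsHom`. ([IUTchI] Def 3.1 (e) p.62) [claim: Mochizuki2012, status: disputed] -/
theorem continuous_absGalToGK : Continuous D.absGalToGK := by
  haveI := D.isAlgClosure_K
  haveI := D.isScalarTower
  have h0 : Continuous (Field.absoluteGaloisGroup.toAlgEquiv K) := continuous_id
  have h1 := continuous_localToGlobal K (D.algClosureEquiv : Fbar →ₐ[K] AlgebraicClosure K)
  have h2 : Continuous (galoisSubgroupOfEquiv F K Fbar) :=
    continuous_induced_rng.2
      (Literature.NumberTheory.GaloisRepresentations.continuous_restrictScalarsHom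
        (k := F) (K := K) (Ω := Fbar))
  exact h2.comp (h1.comp h0)

/-! ### The number-field base data of the `K`-level core -/

/-- `pe.E.gal ≃ₜ G_K`: the continuous bijection `galKIso` from the compact `pe.E.gal` to the Hausdorff
`G_K` is a homeomorphism. ([IUTchI] Def 3.1 (d) p.62) [claim: Mochizuki2012, status: disputed] -/
def galKHomeomorph : D.geom.pe.E.gal ≃ₜ galoisSubgroupOf F K Fbar :=
  haveI := D.t2Space_galF
  D.continuous_galKIso.homeoOfEquivCompactToT2 (f := D.geom.galKIso.toEquiv)

include D in
/-- `Gal(K̄/K) ≃ₜ G_K`: the continuous bijection `absGalToGK` from the compact `Gal(K̄/K)` to the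
Hausdorff `G_K` is a homeomorphism. ([IUTchI] Def 3.1 (e) p.62) [claim: Mochizuki2012, status:
disputed] -/
def absGalHomeomorph : Field.absoluteGaloisGroup K ≃ₜ galoisSubgroupOf F K Fbar :=
  haveI := D.t2Space_galF
  D.continuous_absGalToGK.homeoOfEquivCompactToT2 (f := Equiv.ofBijective _ D.absGalToGK_bijective)

/-- **The Galois group of the core `Π_{C_K} ↠ G_K` of the `K`-level datum IS `Gal(K̄/K)`, bicontinuously**:
`pe.E.gal ≃ₜ* Field.absoluteGaloisGroup K`. ([IUTchI] Def 3.1 (d) p.62) [claim: Mochizuki2012,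
status: disputed] -/
def peGalIso : D.geom.pe.E.gal ≃ₜ* Field.absoluteGaloisGroup K where
  toMulEquiv := D.geom.galKIso.trans (MulEquiv.ofBijective _ D.absGalToGK_bijective).symm
  continuous_toFun := (D.galKHomeomorph.trans D.absGalHomeomorph.symm).continuous
  continuous_invFun := (D.galKHomeomorph.trans D.absGalHomeomorph.symm).symm.continuous

/-- **Number-field base data for the core of the `K`-level §1 datum** (abc-iut-L4-t4's
`FundamentalExtension.NFBase`: "`G ≅ G_F` for a number field `F`" — here the number field is `K`,
[IUTchI] Def. 3.1 (c)(d): `Π_{C_K} ↠ G_K = Gal(F̄/K)`). ([IUTchI] Def 3.1 (d) p.62)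
[claim: Mochizuki2012, status: disputed] -/
def peNFBase : D.geom.pe.E.NFBase where
  F := K
  galIso := D.peGalIso

end InitialThetaData

/-! ### [IUTchI] Cor. 1.2 at the genuine datum: the `Δ`-input is [AbsTopI] Prop. 2.2 alone -/

namespace InitialThetaData

variable {F : Type u} {K : Type} {Fbar : Type} [Field F] [NumberField F] [Field K] [NumberField K]
  [Algebra F K] [Field Fbar] [Algebra F Fbar] [Algebra K Fbar]
  {E : WeierstrassCurve F} [E.IsElliptic] {l : ℕ} {Pb : BadPlacePredicates K}
  (D : InitialThetaData F K Fbar E l Pb)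
  {F' : Type u} {K' : Type} [Field F'] [NumberField F'] [Field K'] [NumberField K'] [Algebra F' K']
  {Fbar' : Type} [Field Fbar'] [Algebra F' Fbar'] [Algebra K' Fbar']
  {E' : WeierstrassCurve F'} [E'.IsElliptic] {l' : ℕ} {Pb' : BadPlacePredicates K'}
  (D' : InitialThetaData F' K' Fbar' E' l' Pb')

/-- **[IUTchI] Cor. 1.2 between the `K`-level data of two initial Θ-data (`K`, `K'`, `F̄`, `F̄'` in
universe `0`), `Δ`-input = [AbsTopI] Prop. 2.2 `GeomTFG` at the two cores ALONE**: abc-iut-L5-d4's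
`pe_characteristicNatureOfCoverings_of_geomTFG` (p441649) with its number-field base data supplied by
`peNFBase` ([AbsAnab] Thm. 1.1.2 PROVED in the tree ⇒ `Θ(Δ_C) = Δ'_C` for every core isomorphism `Θ`).
Remaining binders: the printed claims of p. 38 ×2, the cusp interfaces ×2, the ramification of `ε⁰` ×2
(GAP-LEDGER G-L5d4g6-1), `GeomTFG` ×2, `htf`, `huniq'`, `hext`, `hextC`, `hLem45`, `hLem45C`.
([IUTchI] Cor 1.2 p.39) [claim: Mochizuki2012, status: disputed] -/
theorem pe_characteristicNatureOfCoverings_of_geomTFG' (h : D.geom.pe.ArrowCoveringClaims)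
    (h' : D'.geom.pe.ArrowCoveringClaims) (C : D.geom.pe.CuspGalois) (C' : D'.geom.pe.CuspGalois)
    (h0 : ¬ D.geom.pe.inertia D.geom.pe.ε0 ≤ D.geom.pe.piXarrow)
    (h0' : ¬ D'.geom.pe.inertia D'.geom.pe.ε0 ≤ D'.geom.pe.piXarrow)
    (hΔ : D.geom.pe.E.GeomTFG) (hΔ' : D'.geom.pe.E.GeomTFG)
    (htf : IsMulTorsionFree ↥(D.geom.pe.PiX ⊓ D.geom.pe.DeltaC))
    (huniq' : ∀ J ∈ semiEllipticDoubleCoverSubgroups D'.geom.pe.E,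
      J ⊓ D'.geom.pe.DeltaC = D'.geom.pe.PiX ⊓ D'.geom.pe.DeltaC)
    (hext : ∀ φ : D.geom.pe.piXarrow ≃* D'.geom.pe.piXarrow, Continuous φ → Continuous φ.symm →
      ∃ Θ : D.geom.pe.PiC ≃ₜ* D'.geom.pe.PiC,
        ∀ x : D.geom.pe.piXarrow, Θ (x : D.geom.pe.PiC) = (φ x : D'.geom.pe.PiC))
    (hextC : ∀ ψ : D.geom.pe.piCarrow ≃* D'.geom.pe.piCarrow, Continuous ψ → Continuous ψ.symm →
      ∃ Θ : D.geom.pe.PiC ≃ₜ* D'.geom.pe.PiC,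
        ∀ x : D.geom.pe.piCarrow, Θ (x : D.geom.pe.PiC) = (ψ x : D'.geom.pe.PiC))
    (hLem45 : ∀ Θ : D.geom.pe.PiC ≃* D'.geom.pe.PiC, Continuous Θ → Continuous Θ.symm →
      D.geom.pe.PiXbar.map Θ.toMonoidHom = D'.geom.pe.PiXbar →
        (∀ x : D.geom.pe.Cusp, ∃ x' : D'.geom.pe.Cusp, ∃ t' ∈ D'.geom.pe.PiXbar,
          (D.geom.pe.decomp x).map Θ.toMonoidHom = MulAut.conj t' • D'.geom.pe.decomp x') ∧
        (∀ x' : D'.geom.pe.Cusp, ∃ x : D.geom.pe.Cusp, ∃ t' ∈ D'.geom.pe.PiXbar,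
          (D.geom.pe.decomp x).map Θ.toMonoidHom = MulAut.conj t' • D'.geom.pe.decomp x'))
    (hLem45C : ∀ Θ : D.geom.pe.PiC ≃* D'.geom.pe.PiC, Continuous Θ → Continuous Θ.symm →
      D.geom.pe.PiCbar.map Θ.toMonoidHom = D'.geom.pe.PiCbar →
        (∀ x : D.geom.pe.Cusp, x ≠ D.geom.pe.ε0 → ∃ x' : D'.geom.pe.Cusp, x' ≠ D'.geom.pe.ε0 ∧
          ∃ t' ∈ D'.geom.pe.PiCbar,
            (D.geom.pe.decomp x).map Θ.toMonoidHom = MulAut.conj t' • D'.geom.pe.decomp x') ∧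
        (∀ x' : D'.geom.pe.Cusp, x' ≠ D'.geom.pe.ε0 → ∃ x : D.geom.pe.Cusp, x ≠ D.geom.pe.ε0 ∧
          ∃ t' ∈ D'.geom.pe.PiCbar,
            (D.geom.pe.decomp x).map Θ.toMonoidHom = MulAut.conj t' • D'.geom.pe.decomp x')) :
    D.geom.pe.CharacteristicNatureOfCoverings D'.geom.pe :=
  D.pe_characteristicNatureOfCoverings_of_geomTFG D' h h' C C' h0 h0' D.peNFBase D'.peNFBase hΔ hΔ'
    htf huniq' hext hextC hLem45 hLem45C


/-- **The same with [AbsTopI] Lem. 4.5 (v) BY NAME** (`hLem45` ↦ one cuspidal algorithm `A` with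
`RecoversCusps` at the two `X̲`-extensions, p442282), number-field base data supplied by `peNFBase`:
binders `ArrowCoveringClaims` ×2, `CuspGalois` ×2, ramification of `ε⁰` ×2, `GeomTFG` ×2, `htf`,
`huniq'`, `hext`, `hextC`, `A` + `RecoversCusps` ×2, `hLem45C`. ([IUTchI] Cor 1.2 p.39)
[claim: Mochizuki2012, status: disputed] -/
theorem pe_characteristicNatureOfCoverings_of_recoversCusps' (h : D.geom.pe.ArrowCoveringClaims)
    (h' : D'.geom.pe.ArrowCoveringClaims) (C : D.geom.pe.CuspGalois) (C' : D'.geom.pe.CuspGalois)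
    (h0 : ¬ D.geom.pe.inertia D.geom.pe.ε0 ≤ D.geom.pe.piXarrow)
    (h0' : ¬ D'.geom.pe.inertia D'.geom.pe.ε0 ≤ D'.geom.pe.piXarrow)
    (hΔ : D.geom.pe.E.GeomTFG) (hΔ' : D'.geom.pe.E.GeomTFG)
    (htf : IsMulTorsionFree ↥(D.geom.pe.PiX ⊓ D.geom.pe.DeltaC))
    (huniq' : ∀ J ∈ semiEllipticDoubleCoverSubgroups D'.geom.pe.E,
      J ⊓ D'.geom.pe.DeltaC = D'.geom.pe.PiX ⊓ D'.geom.pe.DeltaC)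
    (hext : ∀ φ : D.geom.pe.piXarrow ≃* D'.geom.pe.piXarrow, Continuous φ → Continuous φ.symm →
      ∃ Θ : D.geom.pe.PiC ≃ₜ* D'.geom.pe.PiC,
        ∀ x : D.geom.pe.piXarrow, Θ (x : D.geom.pe.PiC) = (φ x : D'.geom.pe.PiC))
    (hextC : ∀ ψ : D.geom.pe.piCarrow ≃* D'.geom.pe.piCarrow, Continuous ψ → Continuous ψ.symm →
      ∃ Θ : D.geom.pe.PiC ≃ₜ* D'.geom.pe.PiC,
        ∀ x : D.geom.pe.piCarrow, Θ (x : D.geom.pe.PiC) = (ψ x : D'.geom.pe.PiC))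
    (A : CuspidalAlgorithm.{0}) (hA : A.RecoversCusps D.geom.pe.extXbar C.cuspidalDataXbar)
    (hA' : A.RecoversCusps D'.geom.pe.extXbar C'.cuspidalDataXbar)
    (hLem45C : ∀ Θ : D.geom.pe.PiC ≃* D'.geom.pe.PiC, Continuous Θ → Continuous Θ.symm →
      D.geom.pe.PiCbar.map Θ.toMonoidHom = D'.geom.pe.PiCbar →
        (∀ x : D.geom.pe.Cusp, x ≠ D.geom.pe.ε0 → ∃ x' : D'.geom.pe.Cusp, x' ≠ D'.geom.pe.ε0 ∧
          ∃ t' ∈ D'.geom.pe.PiCbar,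
            (D.geom.pe.decomp x).map Θ.toMonoidHom = MulAut.conj t' • D'.geom.pe.decomp x') ∧
        (∀ x' : D'.geom.pe.Cusp, x' ≠ D'.geom.pe.ε0 → ∃ x : D.geom.pe.Cusp, x ≠ D.geom.pe.ε0 ∧
          ∃ t' ∈ D'.geom.pe.PiCbar,
            (D.geom.pe.decomp x).map Θ.toMonoidHom = MulAut.conj t' • D'.geom.pe.decomp x')) :
    D.geom.pe.CharacteristicNatureOfCoverings D'.geom.pe :=
  D.pe_characteristicNatureOfCoverings_of_recoversCusps D' h h' C C' h0 h0' D.peNFBase D'.peNFBase hΔ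
    hΔ' htf huniq' hext hextC A hA hA' hLem45C

end InitialThetaData

end Literature.IUT.HodgeTheaters

end
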